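import Literature.Probability.LatticeModels.GHSInequality
import Literature.Probability.LatticeModels.MeanFieldBoundProofs
import Literature.Probability.LatticeModels.MeanFieldAveraged
import Literature.Probability.LatticeModels.MeanFieldDifferentialInequality
import Mathlib.Analysis.SpecificLimits.Normed
import HarnessLib

/-!
# `β̃_c ≤ β_c` from the GHS inequality, and crit-ising.S08 from Lemma 2.6 alone

Topic `Probability/LatticeModels`; namespaces `Literature.StatMech` (a GHS interpolation bound for the
spin systems `ν_{Λ;K}` of `GKSInequalities` and for the finite-volume Ising model) and
`Literature.CritIsing` (consequences on `ℤ^d` for the mean-field lower bound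
`Literature.Probability.LatticeModels.meanField_lower_bound`, crit-ising.S08 in the form of `Sharpness.lean`).

## The GHS interpolation bound (Part A)

For a spin system `ν_{Λ;K}` with couplings `Kᵢ ≥ 0` on supports of at most two sites and a set
`B` of *one-body* terms `Kᵢ σ_{pᵢ}`, `i ∈ B`, switch the terms of `B` on linearly,
`K(t) = K` off `B`, `t Kᵢ` on `B` (`cplAt`, `LebowitzInequality`). Then
`d/dt ⟨σ_a⟩_t = ∑_{i ∈ B} Kᵢ ⟨σ_a; σ_{pᵢ}⟩_t` and, by the GHS inequality
(`Literature.Probability.LatticeModels.gksExpect_ghs`: `u₃ ≤ 0`), `d/dt ⟨σ_a; σ_y⟩_t = ∑_{i∈B} Kᵢ u₃(a, y, pᵢ) ≤ 0`: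
the truncated two-point functions are nonincreasing in nonnegative fields (Griffiths–Hurst–
Sherman 1970; Lebowitz 1974, Remark (ii): "`⟨q_A⟩` is a decreasing function of the external
fields"). Hence `t ↦ ⟨σ_a⟩_t` is concave on `[0, 1]` and
`⟨σ_a⟩_K - ⟨σ_a⟩_{K off B} ≤ ∑_{i ∈ B} Kᵢ ⟨σ_a; σ_{pᵢ}⟩_{K off B}`
(`gksExpect_spinAt_sub_cplOff_le`). The `+` boundary condition of the Ising model in `Λ` is the
free one plus the one-body terms `β σ_x` for every edge `{x, y}`, `x ∈ Λ`, `y ∉ Λ`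
(Friedli–Velenik 2017, §3.8.1, p. 141: `K_{{i}} = h + β #{j ∉ Λ : j ∼ i}`), whence
(`isingCorr_plus_sub_free_le_boundary_cov`), for `β, h ≥ 0` and `a ∈ Λ`,

  `⟨σ_a⟩⁺_{Λ;β,h} - ⟨σ_a⟩^∅_{Λ;β,h} ≤ β ∑_{x ∈ Λ} ∑_{y ∼ x, y ∉ Λ} ⟨σ_a; σ_x⟩^∅_{Λ;β,h}`.

At `h = 0` the right side is `β ∑ ⟨σ_aσ_x⟩^∅_{Λ;β,0}` over the inner boundary (with
multiplicity), and `⟨σ_a⟩^∅_{Λ;β,0} = 0`; at `h > 0` it is `(β/2) ε(Λ,β,βh)` with the correcting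
term `ε` of Duminil-Copin–Tassion's 2018 correction (`dctBoundaryError`, `MeanFieldLowerBound`).

## Consequences on `ℤ^d` (Part B)

* `spontaneousMagnetization_le_boundary_twoPoint`:
  `m*(β) ≤ β ∑_{x ∈ Λ_L} ∑_{y ∼ x, y ∉ Λ_L} ⟨σ₀σ_x⟩^∅_{Λ_L;β,0}` for every box `Λ_L`.
* `spontaneousMagnetization_eq_zero_of_mem_dctIsingSet_ghs`: **`m*(β) = 0` whenever
  `φ_β(S) < 1` for some finite `S ∋ 0`**, i.e. `β̃_c ≤ β_c` (Duminil-Copin–Tassion 2016, §2.1: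
  items 2–3 "directly imply" `β_c = β̃_c`): the free two-point function decays exponentially
  (`twoPointFree_exp_decay_of_dctIsingPhi_lt_one`, from the tree's finite-volume modified Simon
  inequality), so the boundary sum is `O(L^d e^{-cL}) → 0`. This replaces the plus-state
  Lemma 2.7 (`MeanFieldBoundProofs.dct_modifiedSimon`) in the assembly of crit-ising.S08.
* `meanField_lower_bound_of_eq26`: **crit-ising.S08 (`meanField_lower_bound`) from
  Duminil-Copin–Tassion's eq. (2.6) alone** (`SharpnessSubcritical.dct_magnetization_lower_bound`),
  Peierls' theorem being the tree's `exists_spontaneousMagnetization_pos_holds`.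
* `dct_magnetization_lower_bound_of_lemma26`: eq. (2.6) from the corrected Lemma 2.6
  (`dct_meanField_differentialInequality`) and the vanishing of its correcting term
  (`dct_boundaryError_tendsto_zero`) only — the fourth fact of `MeanFieldLowerBound`
  (`lim_{h↘0} ⟨σ₀⟩^∅_{β,h} = m*(β)`, i.e. uniqueness at `h ≠ 0`) is bypassed: `⟨σ₀⟩^∅ ≤ ⟨σ₀⟩⁺`
  at `h > 0` (GKS) and `h ↦ ⟨σ₀⟩⁺_{β,h}` is right-continuous at `0`
  (`plusCorr_continuousWithinAt_Ici_field`), which is all Duminil-Copin–Tassion's "letting `h`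
  tend to `0`" needs for a *lower* bound on `m*`.
* `freeCorr_eq_plusCorr_singleton_of_pos_of_boundaryError`: conversely the GHS bound shows that
  `dct_boundaryError_tendsto_zero` implies the uniqueness fact
  `freeCorr_eq_plusCorr_singleton_of_pos` (`0 ≤ ⟨σ₀⟩⁺_{Λ_L} - ⟨σ₀⟩^∅_{Λ_L} ≤ (β/2) ε(Λ_L) → 0`).
* `meanField_lower_bound_of_lemma26`, `twoPoint_exponentialDecay_of_lemma26`: crit-ising.S08
  (both forms) from `dct_meanField_differentialInequality` and `dct_boundaryError_tendsto_zero`.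
* `meanField_lower_bound_holds`: **crit-ising.S08 (`meanField_lower_bound`) holds**, feeding
  `meanField_lower_bound_of_eq26` with the tree theorems
  `dct_magnetization_lower_bound_of_differentialInequality` (`MeanFieldAveraged`) and
  `dct_meanField_differentialInequality_holds` (`MeanFieldDifferentialInequality`).

## References

* R. B. Griffiths, C. A. Hurst, S. Sherman, J. Math. Phys. 11 (1970) 790 (GHS inequality).
* J. L. Lebowitz, *GHS and other inequalities*, Comm. Math. Phys. 35 (1974) 87, Remark (ii).
* S. Friedli, Y. Velenik, *Statistical Mechanics of Lattice Systems*, CUP 2017, §3.8.1 (p. 141),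
  Exercise 3.30, Remark 3.30, Lemma 3.31, Def. 3.32.
* H. Duminil-Copin, V. Tassion, CMP 343 (2016) 725, §2.1, eq. (2.6), §2.4 (arXiv:1502.03050
  numbering); Correction CMP 359 (2018) 821.
* M. Aizenman, D. J. Barsky, R. Fernández, J. Stat. Phys. 47 (1987) 343, Thm. 1.
-/

noncomputable section

open Finset Filter Topology MeasureTheory Set
open scoped symmDiff

namespace Literature.Probability.LatticeModels

/-! ## Part A. The GHS interpolation bound -/

section GKS

variable {Λ : Type*} [Fintype Λ] [DecidableEq Λ] {ι : Type*} [DecidableEq ι]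
variable (s : Finset ι) (K : ι → ℝ) (C : ι → Finset Λ) (B : Finset ι) (p : ι → Λ)

omit [Fintype Λ] [DecidableEq Λ] in
/-- On a set `B` of one-body terms, `H_B = ∑_{i ∈ B} Kᵢ σ_{pᵢ}`. [folklore] -/
theorem gksHamiltonian_cplOn_eq_single (hBs : B ⊆ s) (hB : ∀ i ∈ B, C i = {p i})
    (ω : SpinConfig Λ) :
    gksHamiltonian s (cplOn K B) C ω = ∑ i ∈ B, K i * spinAt (p i) ω := by
  simp only [gksHamiltonian, cplOn, ite_mul, zero_mul]
  rw [Finset.sum_ite_mem, Finset.inter_eq_right.2 hBs]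
  refine Finset.sum_congr rfl fun i hi => ?_
  rw [hB i hi, spinProduct, Finset.prod_singleton]

/-- `Z⟨F H_B⟩ = ∑_{i ∈ B} Kᵢ Z⟨F σ_{pᵢ}⟩` for one-body terms. [folklore] -/
theorem gksSum_mul_cplOn_single (hBs : B ⊆ s) (hB : ∀ i ∈ B, C i = {p i}) (K' : ι → ℝ)
    (F : SpinConfig Λ → ℝ) :
    gksSum s K' C (fun ω => F ω * gksHamiltonian s (cplOn K B) C ω) =
      ∑ i ∈ B, K i * gksSum s K' C (fun ω => F ω * spinAt (p i) ω) := by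
  simp only [gksSum, gksHamiltonian_cplOn_eq_single s K C B p hBs hB, Finset.mul_sum,
    Finset.sum_mul]
  rw [Finset.sum_comm]
  exact Finset.sum_congr rfl fun i _ => Finset.sum_congr rfl fun ω _ => by ring

/-- **The derivative in one-body couplings is a sum of truncated correlations**:
`d/dt ⟨F⟩_t = ∑_{i ∈ B} Kᵢ (⟨F σ_{pᵢ}⟩_t - ⟨F⟩_t ⟨σ_{pᵢ}⟩_t)` along `cplAt K B t`
(Glimm–Jaffe 1987, Prop. 4.2.1, for one-body terms). [cite: GlimmJaffe1987, §4.2, Prop. 4.2.1] -/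
theorem hasDerivAt_gksExpect_cplAt_cov_single (hBs : B ⊆ s) (hB : ∀ i ∈ B, C i = {p i})
    (F : SpinConfig Λ → ℝ) (t : ℝ) :
    HasDerivAt (fun t => gksExpect s (cplAt K B t) C F)
      (∑ i ∈ B, K i * (gksExpect s (cplAt K B t) C (fun ω => F ω * spinAt (p i) ω) -
        gksExpect s (cplAt K B t) C F * gksExpect s (cplAt K B t) C (spinAt (p i)))) t := by
  have h := hasDerivAt_gksExpect_cplAt s K C B F t
  have hZ := gksSum_one_pos s (cplAt K B t) C
  set Z := gksSum s (cplAt K B t) C (fun _ => 1) with hZdef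
  convert h using 1
  rw [gksSum_mul_cplOn_single s K C B p hBs hB, gksSum_mul_cplOn_single s K C B p hBs hB]
  simp only [gksExpect, ← hZdef, one_mul]
  have hpt : ∀ i ∈ B, K i * (gksSum s (cplAt K B t) C (fun ω => F ω * spinAt (p i) ω) / Z -
      gksSum s (cplAt K B t) C F / Z * (gksSum s (cplAt K B t) C (spinAt (p i)) / Z)) =
      (K i * (gksSum s (cplAt K B t) C (fun ω => F ω * spinAt (p i) ω) * Z) -
        gksSum s (cplAt K B t) C F * (K i * gksSum s (cplAt K B t) C (spinAt (p i)))) /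
          Z ^ 2 := by
    intro i _
    field_simp
  rw [Finset.sum_congr rfl hpt, ← Finset.sum_div]
  congr 1
  rw [Finset.sum_mul, Finset.mul_sum, ← Finset.sum_sub_distrib]
  exact Finset.sum_congr rfl fun i _ => by ring

/-- **GHS monotonicity of truncated two-point functions in one-body couplings** (Lebowitz 1974,
Remark (ii) after the proof of the Theorem: for nonnegative fields "`⟨q_A⟩` is a decreasing …
function of the external fields"; Griffiths–Hurst–Sherman 1970): along `cplAt K B t`, `B` a set
of one-body terms, `t ↦ ⟨σ_aσ_y⟩_t - ⟨σ_a⟩_t⟨σ_y⟩_t` is nonincreasing on `[0, ∞)`, its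
derivative being `∑_{i ∈ B} Kᵢ u₃(a, y, pᵢ) ≤ 0`. [cite: Lebowitz1974, §2, Remark (ii) following the proof of the Theorem] -/
theorem antitoneOn_gksTrunc_cplAt (hK : ∀ i ∈ s, 0 ≤ K i) (hC : ∀ i ∈ s, (C i).card ≤ 2)
    (hBs : B ⊆ s) (hB : ∀ i ∈ B, C i = {p i}) (a y : Λ) :
    AntitoneOn (fun t => gksExpect s (cplAt K B t) C (fun ω => spinAt a ω * spinAt y ω) -
      gksExpect s (cplAt K B t) C (spinAt a) * gksExpect s (cplAt K B t) C (spinAt y)) (Ici 0) := by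
  have hd : ∀ t, HasDerivAt (fun t => gksExpect s (cplAt K B t) C (fun ω => spinAt a ω * spinAt y ω) -
      gksExpect s (cplAt K B t) C (spinAt a) * gksExpect s (cplAt K B t) C (spinAt y))
      ((∑ i ∈ B, K i *
          (gksExpect s (cplAt K B t) C (fun ω => spinAt a ω * spinAt y ω * spinAt (p i) ω) -
            gksExpect s (cplAt K B t) C (fun ω => spinAt a ω * spinAt y ω) *
              gksExpect s (cplAt K B t) C (spinAt (p i)))) -
        ((∑ i ∈ B, K i * (gksExpect s (cplAt K B t) C (fun ω => spinAt a ω * spinAt (p i) ω) -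
            gksExpect s (cplAt K B t) C (spinAt a) * gksExpect s (cplAt K B t) C (spinAt (p i)))) *
            gksExpect s (cplAt K B t) C (spinAt y) +
          gksExpect s (cplAt K B t) C (spinAt a) *
            ∑ i ∈ B, K i * (gksExpect s (cplAt K B t) C (fun ω => spinAt y ω * spinAt (p i) ω) -
              gksExpect s (cplAt K B t) C (spinAt y) * gksExpect s (cplAt K B t) C (spinAt (p i)))))
      t := by
    intro t
    have h1 := hasDerivAt_gksExpect_cplAt_cov_single s K C B p hBs hB
      (fun ω => spinAt a ω * spinAt y ω) t
    have h2 := hasDerivAt_gksExpect_cplAt_cov_single s K C B p hBs hB (spinAt a) t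
    have h3 := hasDerivAt_gksExpect_cplAt_cov_single s K C B p hBs hB (spinAt y) t
    exact h1.sub (h2.mul h3)
  refine antitoneOn_of_deriv_nonpos (convex_Ici 0)
    (fun t _ => (hd t).continuousAt.continuousWithinAt)
    (fun t _ => (hd t).differentiableAt.differentiableWithinAt) ?_
  intro t ht
  rw [interior_Ici] at ht
  have ht0 : 0 ≤ t := le_of_lt ht
  rw [(hd t).deriv]
  have hKt := cplAt_nonneg s K B hK ht0
  have hsum : (∑ i ∈ B, K i *
          (gksExpect s (cplAt K B t) C (fun ω => spinAt a ω * spinAt y ω * spinAt (p i) ω) -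
            gksExpect s (cplAt K B t) C (fun ω => spinAt a ω * spinAt y ω) *
              gksExpect s (cplAt K B t) C (spinAt (p i)))) -
        ((∑ i ∈ B, K i * (gksExpect s (cplAt K B t) C (fun ω => spinAt a ω * spinAt (p i) ω) -
            gksExpect s (cplAt K B t) C (spinAt a) * gksExpect s (cplAt K B t) C (spinAt (p i)))) *
            gksExpect s (cplAt K B t) C (spinAt y) +
          gksExpect s (cplAt K B t) C (spinAt a) *
            ∑ i ∈ B, K i * (gksExpect s (cplAt K B t) C (fun ω => spinAt y ω * spinAt (p i) ω) -
              gksExpect s (cplAt K B t) C (spinAt y) * gksExpect s (cplAt K B t) C (spinAt (p i)))) =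
      ∑ i ∈ B, K i *
        (gksExpect s (cplAt K B t) C (fun ω => spinAt a ω * spinAt y ω * spinAt (p i) ω) -
          gksExpect s (cplAt K B t) C (fun ω => spinAt a ω * spinAt y ω) *
            gksExpect s (cplAt K B t) C (spinAt (p i)) -
          gksExpect s (cplAt K B t) C (fun ω => spinAt a ω * spinAt (p i) ω) *
            gksExpect s (cplAt K B t) C (spinAt y) -
          gksExpect s (cplAt K B t) C (fun ω => spinAt y ω * spinAt (p i) ω) *
            gksExpect s (cplAt K B t) C (spinAt a) +
          2 * (gksExpect s (cplAt K B t) C (spinAt a) * gksExpect s (cplAt K B t) C (spinAt y) *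
            gksExpect s (cplAt K B t) C (spinAt (p i)))) := by
    rw [Finset.sum_mul, Finset.mul_sum, ← Finset.sum_add_distrib, ← Finset.sum_sub_distrib]
    exact Finset.sum_congr rfl fun i _ => by ring
  rw [hsum]
  refine Finset.sum_nonpos fun i hi => ?_
  exact mul_nonpos_iff.2 (Or.inl ⟨hK i (hBs hi), gksExpect_ghs s (cplAt K B t) C hKt hC a y (p i)⟩)

/-- **The GHS interpolation bound**: for `Kᵢ ≥ 0` on supports of at most two sites and a set
`B` of one-body terms `Kᵢ σ_{pᵢ}`,
`⟨σ_a⟩_K - ⟨σ_a⟩_{K off B} ≤ ∑_{i ∈ B} Kᵢ (⟨σ_aσ_{pᵢ}⟩ - ⟨σ_a⟩⟨σ_{pᵢ}⟩)_{K off B}`: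
`t ↦ ⟨σ_a⟩_{cplAt K B t}` has the nonincreasing derivative `∑_{i∈B} Kᵢ ⟨σ_a; σ_{pᵢ}⟩_t`
(`antitoneOn_gksTrunc_cplAt`), so its increment over `[0, 1]` is at most the derivative at
`t = 0` (mean value inequality). This is the finite-volume form of the classical GHS argument
that boundary fields raise the magnetisation by at most `∑ (field) × (truncated two-point
function)` (Lebowitz 1974, Remark (ii); Friedli–Velenik 2017, §3.9, p. 140). [cite: Lebowitz1974, §2, Remark (ii) following the proof of the Theorem] [cite: GlimmJaffe1987, §4.2, Prop. 4.2.1] -/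
theorem gksExpect_spinAt_sub_cplOff_le (hK : ∀ i ∈ s, 0 ≤ K i) (hC : ∀ i ∈ s, (C i).card ≤ 2)
    (hBs : B ⊆ s) (hB : ∀ i ∈ B, C i = {p i}) (a : Λ) :
    gksExpect s K C (spinAt a) - gksExpect s (cplOff K B) C (spinAt a) ≤
      ∑ i ∈ B, K i * (gksExpect s (cplOff K B) C (fun ω => spinAt a ω * spinAt (p i) ω) -
        gksExpect s (cplOff K B) C (spinAt a) * gksExpect s (cplOff K B) C (spinAt (p i))) := by
  set M := ∑ i ∈ B, K i * (gksExpect s (cplOff K B) C (fun ω => spinAt a ω * spinAt (p i) ω) -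
    gksExpect s (cplOff K B) C (spinAt a) * gksExpect s (cplOff K B) C (spinAt (p i))) with hM
  set Φ : ℝ → ℝ := fun t => gksExpect s (cplAt K B t) C (spinAt a) with hΦ
  have hder : ∀ t, HasDerivAt Φ (∑ i ∈ B, K i *
      (gksExpect s (cplAt K B t) C (fun ω => spinAt a ω * spinAt (p i) ω) -
        gksExpect s (cplAt K B t) C (spinAt a) * gksExpect s (cplAt K B t) C (spinAt (p i)))) t :=
    fun t => hasDerivAt_gksExpect_cplAt_cov_single s K C B p hBs hB (spinAt a) t
  -- the derivative is nonincreasing, hence bounded by its value `M` at `t = 0` on `[0, 1]`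
  have hbound : ∀ t, 0 ≤ t → ∑ i ∈ B, K i *
      (gksExpect s (cplAt K B t) C (fun ω => spinAt a ω * spinAt (p i) ω) -
        gksExpect s (cplAt K B t) C (spinAt a) * gksExpect s (cplAt K B t) C (spinAt (p i))) ≤ M := by
    intro t ht0
    rw [hM, ← cplAt_zero K B]
    refine Finset.sum_le_sum fun i hi => mul_le_mul_of_nonneg_left ?_ (hK i (hBs hi))
    exact antitoneOn_gksTrunc_cplAt s K C B p hK hC hBs hB a (p i) (self_mem_Ici) ht0 ht0
  have hdiff : Differentiable ℝ Φ := fun t => (hder t).differentiableAt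
  have hderiv_le : ∀ t ∈ interior (Set.Icc (0 : ℝ) 1), deriv Φ t ≤ M := by
    intro t ht
    rw [interior_Icc] at ht
    rw [(hder t).deriv]
    exact hbound t ht.1.le
  have hmvt := (convex_Icc (0 : ℝ) 1).image_sub_le_mul_sub_of_deriv_le hdiff.continuous.continuousOn
    hdiff.differentiableOn hderiv_le 0 (Set.left_mem_Icc.2 zero_le_one) 1
    (Set.right_mem_Icc.2 zero_le_one) zero_le_one
  have h1 : Φ 1 = gksExpect s K C (spinAt a) := by simp only [hΦ, cplAt_one]
  have h0 : Φ 0 = gksExpect s (cplOff K B) C (spinAt a) := by simp only [hΦ, cplAt_zero]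
  rw [h1, h0, sub_zero, mul_one] at hmvt
  exact hmvt

omit [DecidableEq ι] in
/-- **Odd observables vanish under the global spin flip**: if every interaction term with nonzero
coupling has even support, then `Z⟨σ_a⟩ = 0` (the spin-flip symmetry at zero field,
Friedli–Velenik 2017, §3.7.1, eq. (3.33)). [cite: FriedliVelenik2017, §3.7.1, eq. (3.33)] -/
theorem gksSum_spinAt_eq_zero_of_even (K' : ι → ℝ) (a : Λ)
    (heven : ∀ i ∈ s, K' i = 0 ∨ Even (C i).card) :
    gksSum s K' C (spinAt a) = 0 := by
  have hw : ∀ σ, gksWeight s K' C (flipOn Finset.univ σ) = gksWeight s K' C σ := by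
    intro σ
    simp only [gksWeight, gksHamiltonian]
    congr 1
    refine Finset.sum_congr rfl fun i hi => ?_
    rw [spinProduct_flipOn, Finset.inter_univ]
    rcases heven i hi with h0 | hev
    · simp [h0]
    · rw [hev.neg_one_pow, one_mul]
  have hodd : ∀ σ, spinAt a (flipOn Finset.univ σ) = -spinAt a σ := by
    intro σ
    simp only [spinAt_flipOn, Finset.mem_univ, if_true]
  unfold gksSum
  have h : ∑ σ, spinAt a σ * gksWeight s K' C σ =
      ∑ σ, spinAt a (flipOn Finset.univ σ) * gksWeight s K' C (flipOn Finset.univ σ) :=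
    (Fintype.sum_bijective _ (flipOn_involutive Finset.univ).bijective _ _ fun _ => rfl).symm
  have h2 : ∑ σ, spinAt a (flipOn Finset.univ σ) * gksWeight s K' C (flipOn Finset.univ σ) =
      -∑ σ, spinAt a σ * gksWeight s K' C σ := by
    rw [← Finset.sum_neg_distrib]
    exact Finset.sum_congr rfl fun σ _ => by rw [hodd, hw]; ring
  linarith

end GKS

/-! ## Part A'. The finite-volume Ising model: `+` versus free boundary condition -/

section Ising

variable {V : Type*} [DecidableEq V] (G : SimpleGraph V) [G.LocallyFinite]

/-- `⟨σ_{{a}}⟩^{bc}_{Λ;β,h} = ⟨σ_a⟩_{Λ;K}` for `a ∈ Λ` (Friedli–Velenik 2017, §3.8.1, p. 141). [cite: FriedliVelenik2017, §3.8.1, p. 141] -/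
theorem isingCorr_singleton_eq_gksExpect (Λ : Finset V) (β h : ℝ) (bc : BoundaryCondition V)
    {a : V} (ha : a ∈ Λ) :
    isingCorr G Λ β h bc {a} =
      gksExpect (isingIdx G Λ) (gksCoupling G Λ β h bc) (isingSupp Λ) (spinAt (⟨a, ha⟩ : ↥Λ)) := by
  rw [isingCorr_eq_gksExpect G Λ β h bc (Finset.singleton_subset_iff.2 ha)]
  have hset : inVol Λ {a} = {⟨a, ha⟩} := by
    ext z
    simp only [mem_inVol, Finset.mem_singleton, Subtype.ext_iff]
  rw [hset]
  congr 1
  funext τ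
  rw [spinProduct, Finset.prod_singleton]

/-- `⟨σ_{{a} ∆ {x}}⟩^{bc}_{Λ;β,h} = ⟨σ_aσ_x⟩_{Λ;K}` for `a, x ∈ Λ` (Friedli–Velenik 2017, §3.8.1,
p. 141). [cite: FriedliVelenik2017, §3.8.1, p. 141] -/
theorem isingCorr_pair_eq_gksExpect (Λ : Finset V) (β h : ℝ) (bc : BoundaryCondition V)
    {a x : V} (ha : a ∈ Λ) (hx : x ∈ Λ) :
    isingCorr G Λ β h bc ({a} ∆ {x}) =
      gksExpect (isingIdx G Λ) (gksCoupling G Λ β h bc) (isingSupp Λ)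
        (fun τ => spinAt (⟨a, ha⟩ : ↥Λ) τ * spinAt (⟨x, hx⟩ : ↥Λ) τ) := by
  have h1 : isingCorr G Λ β h bc ({a} ∆ {x}) = isingTwoPoint G Λ β h bc a x := by
    rw [isingCorr, isingTwoPoint, spinPair_eq_spinProduct_singleton_symmDiff]
  rw [h1, isingTwoPoint_eq_gksExpect G Λ β h bc ha hx]
  rfl

/-- `⟨σ_aσ_x⟩^{bc}_{Λ;β,h} = ⟨σ_{{a} ∆ {x}}⟩^{bc}_{Λ;β,h}` (`σ_aσ_x = σ_{{a}∆{x}}`). [folklore] -/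
theorem isingTwoPoint_eq_isingCorr_symmDiff (Λ : Finset V) (β h : ℝ) (bc : BoundaryCondition V)
    (a x : V) : isingTwoPoint G Λ β h bc a x = isingCorr G Λ β h bc ({a} ∆ {x}) := by
  rw [isingCorr, isingTwoPoint, spinPair_eq_spinProduct_singleton_symmDiff]

/-- **`⟨σ_a⟩^∅_{Λ;β,0} = 0`** (free boundary condition, zero field): the global spin flip
(Friedli–Velenik 2017, §3.7.1, eq. (3.33)). [cite: FriedliVelenik2017, §3.7.1, eq. (3.33)] -/
theorem isingCorr_free_singleton_zero_field (Λ : Finset V) (β : ℝ) {a : V} (ha : a ∈ Λ) :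
    isingCorr G Λ β 0 .free {a} = 0 := by
  rw [isingCorr_singleton_eq_gksExpect G Λ β 0 .free ha, gksExpect,
    gksSum_spinAt_eq_zero_of_even _ _ _ _ ?_, zero_div]
  rintro (e | x) hi
  · by_cases he : e ∈ edgesIn G Λ
    · right
      have he' := (mem_edgesIn_iff.1 he)
      induction e using Sym2.ind with
      | _ u v =>
        have huv : G.Adj u v := (SimpleGraph.mem_edgeSet G).1 he'.1
        have hu : u ∈ Λ := he'.2 u (Sym2.mem_mk_left u v)
        have hv : v ∈ Λ := he'.2 v (Sym2.mem_mk_right u v)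
        have hset : isingSupp Λ (Sum.inl s(u, v)) = {(⟨u, hu⟩ : ↥Λ), ⟨v, hv⟩} := by
          ext w
          simp only [isingSupp, Finset.mem_filter, Finset.mem_univ, true_and, Sym2.mem_iff,
            Finset.mem_insert, Finset.mem_singleton, Subtype.ext_iff]
        rw [hset, Finset.card_pair]
        · exact even_two
        · intro h
          exact G.ne_of_adj huv (congrArg Subtype.val h)
    · left
      simp [gksCoupling, interactionEdges_free, he]
  · left
    simp [gksCoupling]

/-- The ordered boundary bonds of `Λ` — pairs `(x, y)` with `x ∈ Λ`, `y ∉ Λ`, `x ∼ y`, as the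
finset `Λ.sigma (x ↦ {y ∼ x | y ∉ Λ})` (for the `+` boundary condition each contributes the
one-body term `β σ_x`; Friedli–Velenik 2017, §3.8.1, p. 141): membership. [folklore] -/
theorem mem_outPairs {Λ : Finset V} {q : Σ _ : V, V} :
    q ∈ Λ.sigma (fun x => (G.neighborFinset x).filter (· ∉ Λ)) ↔
      q.1 ∈ Λ ∧ q.2 ∉ Λ ∧ G.Adj q.1 q.2 := by
  simp only [Finset.mem_sigma, Finset.mem_filter, SimpleGraph.mem_neighborFinset]
  tauto

/-- `(x, y) ↦ {x, y}` is injective on the ordered boundary bonds (the endpoint in `Λ` is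
determined). [folklore] -/
theorem injOn_outPairs (Λ : Finset V) :
    Set.InjOn (fun q : (Σ _ : V, V) => (Sum.inl s(q.1, q.2) : Sym2 V ⊕ V))
      (Λ.sigma (fun x => (G.neighborFinset x).filter (· ∉ Λ))) := by
  intro q hq r hr h
  simp only [Finset.mem_coe, mem_outPairs] at hq hr
  have h' : s(q.1, q.2) = s(r.1, r.2) := Sum.inl_injective h
  rcases Sym2.eq_iff.1 h' with ⟨h1, h2⟩ | ⟨h1, h2⟩
  · exact Sigma.ext h1 (heq_of_eq h2)
  · exact absurd (h1 ▸ hq.1) hr.2.1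

/-- **GHS boundary-field bound for the Ising model.** On a locally finite graph, for a finite
volume `Λ`, `β ≥ 0`, `h ≥ 0` and `a ∈ Λ`:
`⟨σ_a⟩⁺_{Λ;β,h} - ⟨σ_a⟩^∅_{Λ;β,h} ≤ β ∑_{x ∈ Λ} ∑_{y ∼ x, y ∉ Λ} (⟨σ_aσ_x⟩ - ⟨σ_a⟩⟨σ_x⟩)^∅_{Λ;β,h}`.
The `+` boundary condition is the free one plus the one-body terms `β σ_x`, one for each
boundary bond `{x, y}` (Friedli–Velenik 2017, §3.8.1, p. 141: "`K_{{i}} = h + β #{j ∉ Λ : j ∼ i}`");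
apply `gksExpect_spinAt_sub_cplOff_le` (GHS). [cite: FriedliVelenik2017, §3.8.1, p. 141] [cite: Lebowitz1974, §2, Remark (ii) following the proof of the Theorem] -/
theorem isingCorr_plus_sub_free_le_boundary_cov {Λ : Finset V} {β h : ℝ} (hβ : 0 ≤ β)
    (hh : 0 ≤ h) {a : V} (ha : a ∈ Λ) :
    isingCorr G Λ β h .plus {a} - isingCorr G Λ β h .free {a} ≤
      β * ∑ x ∈ Λ, ∑ _y ∈ (G.neighborFinset x).filter (· ∉ Λ),
        (isingCorr G Λ β h .free ({a} ∆ {x}) -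
          isingCorr G Λ β h .free {a} * isingCorr G Λ β h .free {x}) := by
  classical
  set s := isingIdx G Λ with hs
  set K := gksCoupling G Λ β h .plus with hKdef
  set C := isingSupp Λ with hCdef
  set T := Λ.sigma (fun x => (G.neighborFinset x).filter (· ∉ Λ)) with hT
  set emb : (Σ _ : V, V) → Sym2 V ⊕ V := fun q => Sum.inl s(q.1, q.2) with hemb
  set B := T.image emb with hB
  have hex : ∀ i, i ∈ B → ∃ q, q ∈ T ∧ emb q = i := fun i hi => by
    simpa only [hB, Finset.mem_image] using hi
  haveI : Nonempty (Σ _ : V, V) := ⟨⟨a, a⟩⟩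
  choose! pf hpfT hpf using hex
  set p : Sym2 V ⊕ V → ↥Λ := fun i => if h : (pf i).1 ∈ Λ then ⟨(pf i).1, h⟩ else ⟨a, ha⟩
    with hp
  have hpfT' : ∀ i ∈ B, (pf i).1 ∈ Λ ∧ (pf i).2 ∉ Λ ∧ G.Adj (pf i).1 (pf i).2 :=
    fun i hi => (mem_outPairs G).1 (hpfT i hi)
  have hp_val : ∀ i ∈ B, ((p i : ↥Λ) : V) = (pf i).1 := by
    intro i hi; simp only [hp, dif_pos (hpfT' i hi).1]
  have hTedge : ∀ q ∈ T, s(q.1, q.2) ∈ edgesTouching G Λ := by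
    intro q hq
    obtain ⟨h1, _, hadj⟩ := (mem_outPairs G).1 hq
    exact mem_edgesTouching_iff.2 ⟨(SimpleGraph.mem_edgeSet G).2 hadj, q.1, h1, Sym2.mem_mk_left _ _⟩
  have hBs : B ⊆ s := by
    intro i hi
    obtain ⟨q, hq, rfl⟩ := Finset.mem_image.1 hi
    simp only [hs, isingIdx, hemb, Finset.inl_mem_disjSum]
    exact hTedge q hq
  have hK : ∀ i ∈ s, 0 ≤ K i := gksCoupling_nonneg G hβ hh (Or.inr rfl)
  have hC : ∀ i ∈ s, (C i).card ≤ 2 := fun i _ => card_isingSupp_le_two Λ i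
  have hBC : ∀ i ∈ B, C i = {p i} := by
    intro i hi
    obtain ⟨_, h2, _⟩ := hpfT' i hi
    have hi' : i = Sum.inl s((pf i).1, (pf i).2) := (hpf i hi).symm
    ext w
    rw [Finset.mem_singleton, Subtype.ext_iff, hp_val i hi]
    conv_lhs => rw [hi']
    simp only [hCdef, isingSupp, Finset.mem_filter, Finset.mem_univ, true_and, Sym2.mem_iff]
    constructor
    · rintro (hw | hw)
      · exact hw
      · exact absurd (hw ▸ w.2) h2
    · exact fun hw => Or.inl hw
  -- switching off `B` turns the `+` couplings into the free ones
  have hoff : cplOff K B = gksCoupling G Λ β h .free := by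
    funext i
    rcases i with e | x
    · by_cases hiB : Sum.inl e ∈ B
      · simp only [cplOff, hiB, if_true]
        obtain ⟨q, hq, hqe⟩ := Finset.mem_image.1 hiB
        obtain ⟨_, h2, _⟩ := (mem_outPairs G).1 hq
        have he : e ∉ edgesIn G Λ := by
          intro he
          refine h2 ((mem_edgesIn_iff.1 he).2 q.2 ?_)
          rw [← Sum.inl_injective hqe]
          exact Sym2.mem_mk_right _ _
        simp [gksCoupling, interactionEdges_free, he]
      · simp only [cplOff, hiB, if_false]
        by_cases he : e ∈ edgesIn G Λ
        · rw [hKdef, gksCoupling_inl_of_mem_edgesIn G β h (Or.inr rfl) he,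
            gksCoupling_inl_of_mem_edgesIn G β h (Or.inl rfl) he]
        · have het : e ∉ edgesTouching G Λ := by
            intro het
            obtain ⟨he', x, hx, hxe⟩ := mem_edgesTouching_iff.1 het
            apply hiB
            induction e using Sym2.ind with
            | _ u v =>
              have huv : G.Adj u v := (SimpleGraph.mem_edgeSet G).1 he'
              have hout : u ∉ Λ ∨ v ∉ Λ := by
                by_contra hcon
                push Not at hcon
                exact he (mem_edgesIn_iff.2 ⟨he', fun w hw => by
                  rcases Sym2.mem_iff.1 hw with rfl | rfl
                  exacts [hcon.1, hcon.2]⟩)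
              rcases Sym2.mem_iff.1 hxe with rfl | rfl
              · have hv : v ∉ Λ := hout.resolve_left (not_not.2 hx)
                exact Finset.mem_image.2 ⟨⟨x, v⟩, (mem_outPairs G).2 ⟨hx, hv, huv⟩, rfl⟩
              · have hu : u ∉ Λ := hout.resolve_right (not_not.2 hx)
                refine Finset.mem_image.2 ⟨⟨x, u⟩, (mem_outPairs G).2 ⟨hx, hu, huv.symm⟩, ?_⟩
                simp only [hemb, Sym2.eq_swap]
          have h1 : K (Sum.inl e) = 0 := by
            simp only [hKdef, gksCoupling, BoundaryCondition.plus, interactionEdges_fixed, het,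
              if_false]
          have h2 : gksCoupling G Λ β h .free (Sum.inl e) = 0 := by
            simp only [gksCoupling, interactionEdges_free, he, if_false]
          rw [h1, h2]
    · have hxB : Sum.inr x ∉ B := by
        intro hxB
        obtain ⟨q, _, hq⟩ := Finset.mem_image.1 hxB
        exact Sum.inl_ne_inr hq
      simp only [cplOff, hxB, if_false, hKdef, gksCoupling]
  -- the abstract bound
  have hmain := gksExpect_spinAt_sub_cplOff_le s K C B p hK hC hBs hBC ⟨a, ha⟩
  rw [hoff] at hmain
  have hl : isingCorr G Λ β h .plus {a} - isingCorr G Λ β h .free {a} =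
      gksExpect s K C (spinAt (⟨a, ha⟩ : ↥Λ)) -
        gksExpect s (gksCoupling G Λ β h .free) C (spinAt (⟨a, ha⟩ : ↥Λ)) := by
    rw [isingCorr_singleton_eq_gksExpect G Λ β h .plus ha,
      isingCorr_singleton_eq_gksExpect G Λ β h .free ha]
  rw [hl]
  refine hmain.trans (le_of_eq ?_)
  -- reindex the sum over `B` by the ordered boundary bonds
  rw [hB, Finset.sum_image (injOn_outPairs G Λ)]
  have hterm : ∀ q ∈ T, K (emb q) *
      (gksExpect s (gksCoupling G Λ β h .free) C
          (fun ω => spinAt (⟨a, ha⟩ : ↥Λ) ω * spinAt (p (emb q)) ω) -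
        gksExpect s (gksCoupling G Λ β h .free) C (spinAt (⟨a, ha⟩ : ↥Λ)) *
          gksExpect s (gksCoupling G Λ β h .free) C (spinAt (p (emb q)))) =
      β * (isingCorr G Λ β h .free ({a} ∆ {q.1}) -
        isingCorr G Λ β h .free {a} * isingCorr G Λ β h .free {q.1}) := by
    intro q hq
    have hi : emb q ∈ B := Finset.mem_image_of_mem emb hq
    have hpfq : pf (emb q) = q := injOn_outPairs G Λ (hpfT _ hi) hq (hpf _ hi)
    obtain ⟨h1, _, _⟩ := (mem_outPairs G).1 hq
    have hp1 : p (emb q) = ⟨q.1, h1⟩ := Subtype.ext (by rw [hp_val _ hi, hpfq])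
    rw [hp1, ← isingCorr_pair_eq_gksExpect G Λ β h .free ha h1,
      ← isingCorr_singleton_eq_gksExpect G Λ β h .free ha,
      ← isingCorr_singleton_eq_gksExpect G Λ β h .free h1,
      show K (emb q) = β from gksCoupling_plus_inl G β h (hTedge q hq)]
  rw [Finset.sum_congr rfl hterm, ← Finset.mul_sum]
  congr 1
  rw [hT, Finset.sum_sigma]

/-- **At zero field**: `⟨σ_a⟩⁺_{Λ;β,0} ≤ β ∑_{x ∈ Λ} ∑_{y ∼ x, y ∉ Λ} ⟨σ_aσ_x⟩^∅_{Λ;β,0}`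
(`⟨σ_a⟩^∅_{Λ;β,0} = 0` by the spin flip). This is the GHS route to "finite susceptibility of the
free state kills the spontaneous magnetisation" (cf. Friedli–Velenik 2017, §3.9, p. 140, on the
uses of the GHS inequality). [cite: FriedliVelenik2017, §3.8.1, p. 141, and §3.9, p. 140] [cite: Lebowitz1974, §2, Remark (ii) following the proof of the Theorem] -/
theorem isingCorr_plus_singleton_le_boundary_twoPoint {Λ : Finset V} {β : ℝ} (hβ : 0 ≤ β)
    {a : V} (ha : a ∈ Λ) :
    isingCorr G Λ β 0 .plus {a} ≤
      β * ∑ x ∈ Λ, ∑ _y ∈ (G.neighborFinset x).filter (· ∉ Λ), isingTwoPoint G Λ β 0 .free a x := by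
  have h := isingCorr_plus_sub_free_le_boundary_cov G hβ le_rfl ha
  rw [isingCorr_free_singleton_zero_field G Λ β ha, sub_zero] at h
  simp only [zero_mul, sub_zero] at h
  simpa only [isingTwoPoint_eq_isingCorr_symmDiff] using h

end Ising

end Literature.Probability.LatticeModels

/-! ## Part B. Consequences on `ℤ^d` -/

namespace Literature.Probability.LatticeModels

open Percolation

variable {d : ℕ}

/-- **`m*(β) ≤ β ∑_{x ∈ Λ_L} ∑_{y ∼ x, y ∉ Λ_L} ⟨σ₀σ_x⟩^∅_{Λ_L;β,0}`** for every `L` and `β ≥ 0`: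
`m*(β) = ⟨σ₀⟩⁺_{β,0} ≤ ⟨σ₀⟩⁺_{Λ_L;β,0}` (FKG/GKS volume monotonicity,
`plusCorr_le_isingCorr_plus_box`) and the GHS boundary-field bound at zero field. [cite: FriedliVelenik2017, §3.9, p. 140 (GHS) with Exercise 3.15 / Lemma 3.22] -/
theorem spontaneousMagnetization_le_boundary_twoPoint {β : ℝ} (hβ : 0 ≤ β) (L : ℕ) :
    spontaneousMagnetization d β ≤
      β * ∑ x ∈ box d L, ∑ _y ∈ ((zdGraph d).neighborFinset x).filter (· ∉ box d L),
        isingTwoPoint (zdGraph d) (box d L) β 0 .free 0 x := by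
  have h0 : (0 : Site d) ∈ box d L := zero_mem_box d L
  have h1 : spontaneousMagnetization d β ≤ isingCorr (zdGraph d) (box d L) β 0 .plus {0} := by
    rw [spontaneousMagnetization_eq_plusCorr]
    exact plusCorr_le_isingCorr_plus_box hβ le_rfl (Finset.singleton_subset_iff.2 h0)
  exact h1.trans (isingCorr_plus_singleton_le_boundary_twoPoint (zdGraph d) hβ h0)

/-- A site of `Λ_L` with a neighbour outside `Λ_L` lies on the sphere `‖x‖_∞ = L`. [folklore] -/
theorem supNorm_eq_of_mem_box_of_adj_not_mem {L : ℕ} {x y : Site d} (hx : x ∈ box d L)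
    (hy : y ∉ box d L) (hxy : (zdGraph d).Adj x y) : Site.supNorm x = L := by
  have h1 : Site.supNorm x ≤ L := mem_box_iff_supNorm_le.1 hx
  have h2 : ¬ Site.supNorm y ≤ L := fun h => hy (mem_box_iff_supNorm_le.2 h)
  have h3 : Site.supNorm y ≤ Site.supNorm x + 1 := Site.supNorm_le_succ_of_adj hxy
  omega

/-- **`φ_β(S) < 1 ⇒ m*(β) = 0`, by GHS** (Duminil-Copin–Tassion 2016, §2.1: with `β̃_c` in place
of `β_c`, items 2–3 of Thm. 2.1 "directly imply" `β_c ≥ β̃_c`), for the nearest-neighbour model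
on `ℤ^d`, `β > 0`: the free two-point function decays exponentially
(`twoPointFree_exp_decay_of_dctIsingPhi_lt_one`, all of whose inputs are tree theorems), the
finite-volume free two-point functions are below it (GKS volume monotonicity), so the boundary
sum of `spontaneousMagnetization_le_boundary_twoPoint` is at most
`2d (2L+1)^d e^{-cL} → 0`. [cite: DuminilCopinTassionCMP2016, §2.1 (β̃_c = β_c) with Thm. 2.1 (arXiv:1502.03050 numbering)] [cite: FriedliVelenik2017, §3.9, p. 140] -/
theorem spontaneousMagnetization_eq_zero_of_dctIsingPhi_lt_one_ghs {β : ℝ} (hβ : 0 < β)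
    {S : Finset (Site d)} (h0 : (0 : Site d) ∈ S) (hφ : dctIsingPhi d β S < 1) :
    spontaneousMagnetization d β = 0 := by
  have hgks : ∀ {Λ A : Finset (Site d)} {β h : ℝ} {bc : BoundaryCondition (Site d)},
      gks_one (zdGraph d) (Λ := Λ) (A := A) (β := β) (h := h) (bc := bc) :=
    Literature.Probability.LatticeModels.GKSInequalities.gks_one_holds (zdGraph d)
  have hgks2 : ∀ (G' : SimpleGraph (Site d)) [G'.LocallyFinite] (Λ A B : Finset (Site d))
      (β h : ℝ) (bc : BoundaryCondition (Site d)),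
      gks_two G' (Λ := Λ) (A := A) (B := B) (β := β) (h := h) (bc := bc) :=
    fun G' _ _ _ _ _ _ _ => Literature.Probability.LatticeModels.GKSInequalities.gks_two_holds G'
  have hlim : hasBoxLimit_isingCorr_free d := Literature.Probability.LatticeModels.hasBoxLimit_isingCorr_free_holds
  have hmono : isingCorr_free_mono_volume (d := d) := isingCorr_free_mono_volume_of_gks_two hgks2
  obtain ⟨c, hc, hdec⟩ := twoPointFree_exp_decay_of_dctIsingPhi_lt_one
    dct_modifiedSimon_finiteVolume_holds isingTwoPoint_free_translate_holds hgks hlim hmono hβ h0 hφ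
  -- the boundary sum in the box `Λ_L`
  have hbound : ∀ L : ℕ, spontaneousMagnetization d β ≤
      β * ((2 * d : ℝ) * (2 * L + 1 : ℝ) ^ d * Real.exp (-c * L)) := by
    intro L
    refine (spontaneousMagnetization_le_boundary_twoPoint hβ.le L).trans ?_
    refine mul_le_mul_of_nonneg_left ?_ hβ.le
    have hterm : ∀ x ∈ box d L, ∀ y ∈ ((zdGraph d).neighborFinset x).filter (· ∉ box d L),
        isingTwoPoint (zdGraph d) (box d L) β 0 .free 0 x ≤ Real.exp (-c * L) := by
      intro x hx y hy
      rw [Finset.mem_filter, SimpleGraph.mem_neighborFinset] at hy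
      have hn : Site.supNorm x = L := supNorm_eq_of_mem_box_of_adj_not_mem hx hy.2 hy.1
      refine (isingTwoPoint_free_le_twoPointFree hmono hlim hβ.le (zero_mem_box d L) hx).trans ?_
      refine (hdec x).trans (le_of_eq ?_)
      rw [Site.norm_eq_supNorm, hn]
    calc ∑ x ∈ box d L, ∑ y ∈ ((zdGraph d).neighborFinset x).filter (· ∉ box d L),
          isingTwoPoint (zdGraph d) (box d L) β 0 .free 0 x
        ≤ ∑ x ∈ box d L, ∑ _y ∈ ((zdGraph d).neighborFinset x).filter (· ∉ box d L),
            Real.exp (-c * L) :=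
          Finset.sum_le_sum fun x hx => Finset.sum_le_sum fun y hy => hterm x hx y hy
      _ ≤ ∑ _x ∈ box d L, (2 * d : ℝ) * Real.exp (-c * L) := by
          refine Finset.sum_le_sum fun x _ => ?_
          rw [Finset.sum_const, nsmul_eq_mul]
          refine mul_le_mul_of_nonneg_right ?_ (Real.exp_pos _).le
          have h1 : #(((zdGraph d).neighborFinset x).filter (· ∉ box d L)) ≤ 2 * d :=
            (Finset.card_filter_le _ _).trans (card_neighborFinset_zdGraph_le x)
          exact_mod_cast h1
      _ = (2 * d : ℝ) * (2 * L + 1 : ℝ) ^ d * Real.exp (-c * L) := by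
          rw [Finset.sum_const, nsmul_eq_mul, card_box]
          push_cast
          ring
  -- `(2L+1)^d e^{-cL} → 0`
  set r : ℝ := Real.exp (-c) with hr
  have hr0 : 0 < r := Real.exp_pos _
  have hr1 : r < 1 := Real.exp_lt_one_iff.2 (by linarith)
  have hpow : Tendsto (fun L : ℕ => (L : ℝ) ^ d * r ^ L) atTop (𝓝 0) :=
    tendsto_pow_const_mul_const_pow_of_abs_lt_one d (by rwa [abs_of_pos hr0])
  have hlim0 : Tendsto (fun L : ℕ => β * ((2 * d : ℝ) * (3 : ℝ) ^ d * ((L : ℝ) ^ d * r ^ L)))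
      atTop (𝓝 0) := by
    have := (hpow.const_mul ((2 * d : ℝ) * (3 : ℝ) ^ d)).const_mul β
    simpa only [mul_zero] using this
  have hev : ∀ᶠ L : ℕ in atTop, spontaneousMagnetization d β ≤
      β * ((2 * d : ℝ) * (3 : ℝ) ^ d * ((L : ℝ) ^ d * r ^ L)) := by
    filter_upwards [eventually_ge_atTop 1] with L hL
    refine (hbound L).trans (mul_le_mul_of_nonneg_left ?_ hβ.le)
    have hexp : Real.exp (-c * L) = r ^ L := by
      rw [hr, ← Real.exp_nat_mul]
      congr 1
      ring
    have hL1 : (1 : ℝ) ≤ L := by exact_mod_cast hL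
    have h3 : (2 * L + 1 : ℝ) ^ d ≤ (3 : ℝ) ^ d * (L : ℝ) ^ d := by
      rw [← mul_pow]
      exact pow_le_pow_left₀ (by positivity) (by linarith) d
    rw [hexp]
    have hdn : (0 : ℝ) ≤ 2 * d := by positivity
    calc (2 * d : ℝ) * (2 * L + 1 : ℝ) ^ d * r ^ L
        ≤ (2 * d : ℝ) * ((3 : ℝ) ^ d * (L : ℝ) ^ d) * r ^ L :=
          mul_le_mul_of_nonneg_right (mul_le_mul_of_nonneg_left h3 hdn) (pow_nonneg hr0.le L)
      _ = (2 * d : ℝ) * (3 : ℝ) ^ d * ((L : ℝ) ^ d * r ^ L) := by ring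
  have hle : spontaneousMagnetization d β ≤ 0 := ge_of_tendsto hlim0 hev
  exact le_antisymm hle (spontaneousMagnetization_nonneg_holds hβ.le)

/-- **`β ∈ dctIsingSet d ⇒ m*(β) = 0`** (`β̃_c ≤ β_c`), unconditionally: the case `β > 0` is
`spontaneousMagnetization_eq_zero_of_dctIsingPhi_lt_one_ghs`, the case `β = 0` is
`m*(0) = 0`. Compare `spontaneousMagnetization_eq_zero_of_mem_dctIsingSet` (`MeanFieldBound`),
which assumed the plus-state exponential decay of Duminil-Copin–Tassion's §2.5. [cite: DuminilCopinTassionCMP2016, §2.1 (β̃_c = β_c) with Thm. 2.1 (arXiv:1502.03050 numbering)] -/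
theorem spontaneousMagnetization_eq_zero_of_mem_dctIsingSet_ghs {β : ℝ} (hβD : β ∈ dctIsingSet d) :
    spontaneousMagnetization d β = 0 := by
  obtain ⟨hβ0, S, h0, hφ⟩ := hβD
  rcases hβ0.eq_or_lt with h | hpos
  · rw [← h]
    exact spontaneousMagnetization_zero d
  · exact spontaneousMagnetization_eq_zero_of_dctIsingPhi_lt_one_ghs hpos h0 hφ

/-- **crit-ising.S08 (`meanField_lower_bound`) from Duminil-Copin–Tassion's eq. (2.6) alone.**
Granting the single named fact `dct_magnetization_lower_bound` of `SharpnessSubcritical`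
(the mean-field lower bound `⟨σ₀⟩⁺_β ≥ √(1 - β₁²/β²)` above `β̃_c`, Duminil-Copin–Tassion 2016,
eq. (2.6)), the Aizenman–Barsky–Fernández / Duminil-Copin–Tassion bound
`m*(β) ≥ c √(β - β_c)` near `β_c⁺` holds on `ℤ^d`, `d ≥ 2`: `β̃_c ≤ β_c` is
`spontaneousMagnetization_eq_zero_of_mem_dctIsingSet_ghs` (GHS and the free-state decay),
Peierls' `exists_spontaneousMagnetization_pos` is the tree theorem
`exists_spontaneousMagnetization_pos_holds`, and the assembly is
`meanField_lower_bound_of_zero_on_dctIsingSet` (`MeanFieldBound`). [cite: DuminilCopinTassionCMP2016, Thm. 1.2 (arXiv: Thm. 2.1, first item), §2.1 and eq. (2.6)] [cite: AizenmanBarskyFernandezJSP1987, Thm. 1] -/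
theorem meanField_lower_bound_of_eq26 (hmag : dct_magnetization_lower_bound (d := d)) :
    meanField_lower_bound (d := d) :=
  meanField_lower_bound_of_zero_on_dctIsingSet hmag
    (fun _ hβ => spontaneousMagnetization_eq_zero_of_mem_dctIsingSet_ghs hβ)
    exists_spontaneousMagnetization_pos_holds

/-- **Eq. (2.6) from the corrected Lemma 2.6 and `ε → 0` only** (Duminil-Copin–Tassion 2016,
§2.4, "Inequality (2.6) follows by letting `h` tend to `0`"): as
`dct_magnetization_lower_bound_of_facts` (`MeanFieldLowerBound`), with the GHS concavity
supplied by `ghs_concaveOn_isingCorr_free_singleton_holds` (`GHSInequality`) and the fourth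
fact (`lim_{h ↘ 0} ⟨σ₀⟩^∅_{β,h} = m*(β)`) bypassed: for `h > 0`,
`√((β² - β₁²)/β²) ≤ ⟨σ₀⟩^∅_{β,h} ≤ ⟨σ₀⟩⁺_{β,h}` (GKS, `freeCorr_le_plusCorr`), and
`⟨σ₀⟩⁺_{β,h} → ⟨σ₀⟩⁺_{β,0} = m*(β)` as `h ↘ 0` (`plusCorr_continuousWithinAt_Ici_field`,
Friedli–Velenik 2017, Lemma 3.31 (1) and Remark 3.30). [cite: DuminilCopinTassionCMP2016, §2.4, eq. (2.6) (arXiv:1502.03050 numbering)] [cite: FriedliVelenik2017, Remark 3.30 and Lemma 3.31 (1), pp. 118–119] -/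
theorem dct_magnetization_lower_bound_of_lemma26
    (hdi : dct_meanField_differentialInequality (d := d))
    (hbd : dct_boundaryError_tendsto_zero (d := d)) :
    dct_magnetization_lower_bound (d := d) := by
  intro hd β₁ β hβ₁ hle hφ
  have hβ : 0 < β := hβ₁.trans_le hle
  have hghs : ghs_concaveOn_isingCorr_free_singleton := ghs_concaveOn_isingCorr_free_singleton_holds
  -- lower bound on `M(β, h)` for every `h > 0` (as in `dct_magnetization_lower_bound_of_facts`)
  have hM : ∀ h : ℝ, 0 < h → Real.sqrt ((β ^ 2 - β₁ ^ 2) / β ^ 2) ≤ dctMagInf d β h := by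
    intro h hh
    have hMpos : 0 < dctMagInf d β h := dctMagInf_pos hβ hh
    rcases eq_or_lt_of_le hle with heq | hlt
    · rw [heq, sub_self, zero_div, Real.sqrt_zero]
      exact hMpos.le
    · have hbound : ∀ a ∈ Ioo β₁ β, 1 - (a / β) ^ 2 ≤ dctMagInf d β h ^ 2 := by
        intro a ha
        have := one_sub_dctMagInf_sq_le hdi hbd hghs hd hβ₁ ha.1 ha.2.le hh hφ
        linarith
      have hlimit : 1 - (β₁ / β) ^ 2 ≤ dctMagInf d β h ^ 2 := by
        have hcont : Tendsto (fun a : ℝ => 1 - (a / β) ^ 2) (𝓝[>] β₁) (𝓝 (1 - (β₁ / β) ^ 2)) := by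
          refine tendsto_nhdsWithin_of_tendsto_nhds ?_
          exact ((continuous_const.sub ((continuous_id.div_const β).pow 2)).tendsto β₁)
        refine le_of_tendsto hcont ?_
        have hev : ∀ᶠ a in 𝓝[>] β₁, a ∈ Ioo β₁ β := Ioo_mem_nhdsGT hlt
        filter_upwards [hev] with a ha using hbound a ha
      have hsq : (β ^ 2 - β₁ ^ 2) / β ^ 2 = 1 - (β₁ / β) ^ 2 := by
        field_simp
      rw [hsq]
      calc Real.sqrt (1 - (β₁ / β) ^ 2) ≤ Real.sqrt (dctMagInf d β h ^ 2) := Real.sqrt_le_sqrt hlimit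
        _ = dctMagInf d β h := Real.sqrt_sq hMpos.le
  -- `⟨σ₀⟩^∅_{β,k} ≤ ⟨σ₀⟩⁺_{β,k}` and `k ↘ 0`
  have hplus : ∀ k : ℝ, 0 < k → Real.sqrt ((β ^ 2 - β₁ ^ 2) / β ^ 2) ≤ plusCorr d β k {0} := by
    intro k hk
    have := hM (β * k) (mul_pos hβ hk)
    rw [dctMagInf, mul_div_cancel_left₀ _ hβ.ne'] at this
    exact this.trans (freeCorr_le_plusCorr hβ.le hk.le {0})
  have hrc := plusCorr_continuousWithinAt_Ici_field (d := d) hβ.le {0} le_rfl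
  have ht : Tendsto (fun k : ℝ => plusCorr d β k {0}) (𝓝[>] 0)
      (𝓝 (spontaneousMagnetization d β)) := by
    rw [spontaneousMagnetization_eq_plusCorr]
    exact hrc.tendsto.mono_left (nhdsWithin_mono _ Set.Ioi_subset_Ici_self)
  refine ge_of_tendsto ht ?_
  filter_upwards [self_mem_nhdsWithin] with k hk using hplus k hk

/-- **crit-ising.S08 (`meanField_lower_bound`) from the corrected Lemma 2.6 and `ε → 0`.**
Granting `dct_meanField_differentialInequality` (Duminil-Copin–Tassion 2016, Lemma 2.6, as
corrected in CMP 359 (2018) 821) and `dct_boundaryError_tendsto_zero` (ibid.), the mean-field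
lower bound `m*(β) ≥ c √(β - β_c)` near `β_c⁺` holds on `ℤ^d`, `d ≥ 2`; every other input
(GKS I–II, FKG, GHS, the modified Simon inequality, Peierls' theorem, the box limits,
translation invariance, `β̃_c = β_c`, the integration of the differential inequality) is a
tree theorem. [cite: DuminilCopinTassionCMP2016, Thm. 1.2 (arXiv: Thm. 2.1, first item), Lemma 2.6 and eq. (2.6), with the Correction CMP 359 (2018) 821] [cite: AizenmanBarskyFernandezJSP1987, Thm. 1] -/
theorem meanField_lower_bound_of_lemma26
    (hdi : dct_meanField_differentialInequality (d := d))
    (hbd : dct_boundaryError_tendsto_zero (d := d)) :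
    meanField_lower_bound (d := d) :=
  meanField_lower_bound_of_eq26 (dct_magnetization_lower_bound_of_lemma26 hdi hbd)

/-- **Exponential decay below `β_c` (`twoPoint_exponentialDecay_of_lt_criticalBeta`) from the
corrected Lemma 2.6 and `ε → 0`** (compare `twoPoint_exponentialDecay_of_meanField_facts''` of
`GHSInequality`, which also assumed uniqueness at `h ≠ 0`). [cite: DuminilCopinTassionCMP2016, Thm. 2.1 (third item), §2.4–2.5 (arXiv:1502.03050 numbering)] -/
theorem twoPoint_exponentialDecay_of_lemma26
    (hdi : dct_meanField_differentialInequality (d := d))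
    (hbd : dct_boundaryError_tendsto_zero (d := d)) :
    twoPoint_exponentialDecay_of_lt_criticalBeta (d := d) :=
  twoPoint_exponentialDecay_of_dct_magnetization_lower_bound
    (dct_magnetization_lower_bound_of_lemma26 hdi hbd)

/-! ### Appendix: `ε → 0` implies uniqueness of the one-point function at `h > 0` -/

/-- The GHS boundary-field bound in Duminil-Copin–Tassion's notation: for `β > 0`, `h ≥ 0` and
`0 ∈ Λ`, `0 ≤ ⟨σ₀⟩⁺_{Λ;β,h/β} - ⟨σ₀⟩^∅_{Λ;β,h/β} ≤ (β/2) ε(Λ,β,h)` (tree field `h/β`, DCT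
field `h`). [cite: DuminilCopinTassionCMP2016, Correction CMP 359 (2018) 821, definition of ε(Λ,β,h)] [cite: Lebowitz1974, §2, Remark (ii) following the proof of the Theorem] -/
theorem isingCorr_plus_sub_free_le_dctBoundaryError {Λ : Finset (Site d)} (h0 : (0 : Site d) ∈ Λ)
    {β h : ℝ} (hβ : 0 < β) (hh : 0 ≤ h) :
    isingCorr (zdGraph d) Λ β (h / β) .plus {0} - isingCorr (zdGraph d) Λ β (h / β) .free {0} ≤
      β / 2 * dctBoundaryError d Λ β h := by
  have h1 := isingCorr_plus_sub_free_le_boundary_cov (zdGraph d) hβ.le (div_nonneg hh hβ.le) h0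
  refine h1.trans (le_of_eq ?_)
  simp only [dctBoundaryError, dctMag, dctCorr]
  ring

/-- **`ε(Λ_L,β,h) → 0` implies `⟨σ₀⟩^∅_{β,h} = ⟨σ₀⟩⁺_{β,h}` at `h > 0`**: the named fact
`freeCorr_eq_plusCorr_singleton_of_pos` of `MeanFieldLowerBound` (Friedli–Velenik 2017,
Thm. 3.25 (1), for the one-point function) follows from `dct_boundaryError_tendsto_zero`, since
`0 ≤ ⟨σ₀⟩⁺_{Λ_L} - ⟨σ₀⟩^∅_{Λ_L} ≤ (β/2) ε(Λ_L,β,βh)` and both finite-volume one-point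
functions converge. (At `β = 0` both box sequences vanish identically.) [cite: FriedliVelenik2017, Thm. 3.25 (1), p. 116] [cite: DuminilCopinTassionCMP2016, Correction CMP 359 (2018) 821] -/
theorem freeCorr_eq_plusCorr_singleton_of_pos_of_boundaryError
    (hbd : dct_boundaryError_tendsto_zero (d := d)) :
    freeCorr_eq_plusCorr_singleton_of_pos (d := d) := by
  intro hd β h hβ hh
  have hfree := Literature.Probability.LatticeModels.hasBoxLimit_isingCorr_free_holds (d := d) hβ hh.le {0}
  have hplus := Literature.Probability.LatticeModels.hasBoxLimit_isingCorr_plus_holds (d := d) hβ hh.le {0}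
  rw [HasBoxLimit] at hfree hplus
  rcases hβ.eq_or_lt with h0 | hβpos
  · -- `β = 0`: all finite-volume one-point functions vanish
    have hz : ∀ (bc : BoundaryCondition (Site d)) (L : ℕ),
        isingCorr (zdGraph d) (box d L) 0 h bc {0} = 0 := by
      intro bc L
      rw [isingCorr, ← spinAt_eq_spinProduct_singleton]
      exact isingExpect_spinAt_of_beta_zero (box d L) h bc (zero_mem_box d L)
    rw [← h0] at hfree hplus ⊢
    simp only [hz] at hfree hplus
    rw [tendsto_nhds_unique hfree tendsto_const_nhds, tendsto_nhds_unique hplus tendsto_const_nhds]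
  · -- `β > 0`: squeeze
    have hdiff : Tendsto (fun L : ℕ => isingCorr (zdGraph d) (box d L) β h .plus {0} -
        isingCorr (zdGraph d) (box d L) β h .free {0}) atTop
        (𝓝 (plusCorr d β h {0} - freeCorr d β h {0})) := hplus.sub hfree
    have hε := hbd hd hβpos (mul_pos hβpos hh)
    have hup : Tendsto (fun L : ℕ => β / 2 * dctBoundaryError d (box d L) β (β * h)) atTop (𝓝 0) := by
      simpa only [mul_zero] using hε.const_mul (β / 2)
    have hle : ∀ L : ℕ, isingCorr (zdGraph d) (box d L) β h .plus {0} -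
        isingCorr (zdGraph d) (box d L) β h .free {0} ≤
        β / 2 * dctBoundaryError d (box d L) β (β * h) := by
      intro L
      have := isingCorr_plus_sub_free_le_dctBoundaryError (zero_mem_box d L) hβpos
        (mul_nonneg hβpos.le hh.le) (h := β * h)
      rwa [mul_div_cancel_left₀ _ hβpos.ne'] at this
    have hge : ∀ L : ℕ, 0 ≤ isingCorr (zdGraph d) (box d L) β h .plus {0} -
        isingCorr (zdGraph d) (box d L) β h .free {0} := fun L =>
      sub_nonneg.2 (isingCorr_le_isingCorr_plus (zdGraph d) hβ hh.le .free
        (Finset.singleton_subset_iff.2 (zero_mem_box d L)))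
    have hlim : Tendsto (fun L : ℕ => isingCorr (zdGraph d) (box d L) β h .plus {0} -
        isingCorr (zdGraph d) (box d L) β h .free {0}) atTop (𝓝 0) :=
      tendsto_of_tendsto_of_tendsto_of_le_of_le tendsto_const_nhds hup hge hle
    have := tendsto_nhds_unique hdiff hlim
    linarith

/-- **`lim_{h ↘ 0} ⟨σ₀⟩^∅_{β,h} = m*(β)` from `ε → 0`**: the fourth named fact of
`MeanFieldLowerBound` follows from the second. [cite: FriedliVelenik2017, Remark 3.30, p. 118] -/
theorem freeCorr_singleton_tendsto_spontaneousMagnetization_of_boundaryError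
    (hbd : dct_boundaryError_tendsto_zero (d := d)) :
    freeCorr_singleton_tendsto_spontaneousMagnetization (d := d) :=
  freeCorr_singleton_tendsto_spontaneousMagnetization_of_uniqueness
    (freeCorr_eq_plusCorr_singleton_of_pos_of_boundaryError hbd)

/-! ### crit-ising.S08: `meanField_lower_bound` holds -/

/-- **The mean-field lower bound `m*(β) ≥ c √(β - β_c)` near `β_c⁺` holds** for the
nearest-neighbour Ising model on `ℤ^d`, `d ≥ 2` (Aizenman–Barsky–Fernández, J. Stat. Phys. 47
(1987) 343, Thm. 1; Duminil-Copin–Tassion, CMP 343 (2016) 725, Thm. 1.2 = arXiv Thm. 2.1, first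
item: "`⟨σ₀⟩⁺_β ≥ √((β² - β_c²)/β²)`"): the named fact `Literature.Probability.LatticeModels.meanField_lower_bound` of
`Sharpness.lean`. Assembly: eq. (2.6) (`dct_magnetization_lower_bound`) is the tree theorem
`dct_magnetization_lower_bound_of_differentialInequality` (`MeanFieldAveraged`: integration of the
differential inequality, averaging of the marked site, GHS) fed with the corrected Lemma 2.6
`dct_meanField_differentialInequality_holds` (`MeanFieldDifferentialInequality`: random currents
with a ghost, switching lemma); `β̃_c ≤ β_c` is `spontaneousMagnetization_eq_zero_of_mem_dctIsingSet_ghs`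
(GHS boundary-field bound and the free-state decay from the modified Simon inequality);
`β̃_c ≥ β_c`, `β̃_c = β_c` and the extraction of `c √(β - β_c)` are
`meanField_lower_bound_of_zero_on_dctIsingSet` (`MeanFieldBound`, through
`meanField_lower_bound_of_eq26`), with Peierls' theorem `exists_spontaneousMagnetization_pos_holds`
(`IsingPeierls`). [cite: AizenmanBarskyFernandezJSP1987, Thm. 1] [cite: DuminilCopinTassionCMP2016, Thm. 1.2 (arXiv:1502.03050: Thm. 2.1, first item), §2.1, §2.4 (Lemma 2.6, eq. (2.6)) with the Correction CMP 359 (2018) 821] -/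
theorem meanField_lower_bound_holds : meanField_lower_bound (d := d) :=
  meanField_lower_bound_of_eq26
    (dct_magnetization_lower_bound_of_differentialInequality dct_meanField_differentialInequality_holds)

end Literature.Probability.LatticeModels
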